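import Literature.NumberTheory.Transcendental.KZCalculusProofs
import Literature.NumberTheory.Transcendental.SemialgebraicMapsProofs

/-!
# Route LevelPairing — padding is functorial on rules 1a/1b/2 (the hypothesis `hC` of the telescope)

Support file for items stmt-KontsevichZagierPeriods-4695 (`LevelPairing.SameDimRules12`) and -4696 (`SlabInjective`).
The slab (padding) endomorphism `σ [s] = [s.slab 0]` of `KZ.FormalRep` (`IntegralRep.slab`: domain `σ × [0,1]`, integrand
`f ∘ Fin.init`) maps every instance of rule (1a) (domain additivity), (1b) (integrand additivity) and (2) (change of
variables) of the Kontsevich–Zagier calculus to an instance of the SAME rule one dimension up: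
* (1a): `(σ₁ ∪ σ₂) × [0,1] = σ₁ × [0,1] ∪ σ₂ × [0,1]`, and the cylinder over a null set is null;
* (1b): trivially;
* (2): `Φ` lifts to `Ψ (x, t) = (Φ x, t)`, `ℚ`-semialgebraic (coordinatewise), injective, differentiable within the slab with
  derivative `Φ' ⊕ 1`, whose determinant is `det Φ'` (Laplace expansion along the last row).
Hence `σ` maps KZ₁₂ := closure (1a ∪ 1b ∪ 2) into itself (`slabFunctorial`, verbatim the hypothesis `hC` of
`Cruxes/SameDimRules12/Telescope.lean`).

Sources: M. Kontsevich, D. Zagier, *Periods* (2001), §1.2, rules (1), (2); the calculus of `KZCalculus.lean` /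
`KZCalculusProofs.lean`. Semialgebraic input: coordinate functions of a semialgebraic map
(`isSemialgebraicMapOn_iff_forall_holds`, Tarski–Seidenberg, proved in the tree) and `IsSemialgebraicFunOn.comp_init`.
-/

noncomputable section

namespace Summit.KontsevichZagierPeriods.LevelPairing

open Set MeasureTheory MvPolynomial
open Literature.NumberTheory.Transcendental Literature.NumberTheory.Transcendental.KZ

variable {k : ℕ}

/-! ### Cylinders over null sets are null -/

/-- The cylinder `{z | init z ∈ N} ⊆ ℝᵏ⁺¹` over a Lebesgue-null `N ⊆ ℝᵏ` is Lebesgue-null. [folklore] -/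
theorem volume_setOf_init_mem_eq_zero {N : Set (Fin k → ℝ)} (hN : volume N = 0) :
    volume {z : Fin (k + 1) → ℝ | Fin.init z ∈ N} = 0 := by
  set e : (Fin (k + 1) → ℝ) ≃ᵐ ℝ × (Fin k → ℝ) :=
    MeasurableEquiv.piFinSuccAbove (fun _ => ℝ) (Fin.last k) with he_def
  have he : MeasurePreserving e volume volume :=
    volume_preserving_piFinSuccAbove (fun _ => ℝ) (Fin.last k)
  have he_symm : ∀ p : ℝ × (Fin k → ℝ), e.symm p = Fin.snoc p.2 p.1 := fun p => by
    simp [he_def, MeasurableEquiv.piFinSuccAbove, Fin.snocEquiv]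
  have hpre : e.symm ⁻¹' {z : Fin (k + 1) → ℝ | Fin.init z ∈ N} = univ ×ˢ N := by
    ext p
    simp [he_symm]
  calc volume {z : Fin (k + 1) → ℝ | Fin.init z ∈ N}
      = (Measure.map e.symm volume) {z : Fin (k + 1) → ℝ | Fin.init z ∈ N} := by rw [(he.symm e).map_eq]
    _ = volume (e.symm ⁻¹' {z : Fin (k + 1) → ℝ | Fin.init z ∈ N}) := e.symm.map_apply _
    _ = 0 := by
        rw [hpre, Measure.volume_eq_prod, Measure.prod_prod, hN, mul_zero]

/-! ### Lifting a change of variables through the padding coordinate -/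

/-- The lift `Ψ (x, t) = (Φ x, t)` of a map `Φ : ℝᵏ → ℝᵏ` to `ℝᵏ⁺¹`. [folklore] -/
def liftMap (Φ : (Fin k → ℝ) → (Fin k → ℝ)) (z : Fin (k + 1) → ℝ) : Fin (k + 1) → ℝ :=
  Fin.snoc (Φ (Fin.init z)) (z (Fin.last k))

/-- `Fin.init` as a continuous linear map. [folklore] -/
def initL (k : ℕ) : (Fin (k + 1) → ℝ) →L[ℝ] (Fin k → ℝ) :=
  ContinuousLinearMap.pi fun i => ContinuousLinearMap.proj (Fin.castSucc i)

/-- `initL` is `Fin.init`. [folklore] -/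
@[simp] theorem initL_apply (z : Fin (k + 1) → ℝ) : initL k z = Fin.init z := by
  ext i
  simp [initL, Fin.init]

/-- The lift `A ⊕ 1` of a continuous linear map `A` of `ℝᵏ` to `ℝᵏ⁺¹` (the derivative of `liftMap`). [folklore] -/
def liftCLM (A : (Fin k → ℝ) →L[ℝ] (Fin k → ℝ)) : (Fin (k + 1) → ℝ) →L[ℝ] (Fin (k + 1) → ℝ) :=
  ContinuousLinearMap.pi (Fin.snoc (α := fun _ => (Fin (k + 1) → ℝ) →L[ℝ] ℝ)
    (fun j => (ContinuousLinearMap.proj j).comp (A.comp (initL k))) (ContinuousLinearMap.proj (Fin.last k)))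

/-- `(A ⊕ 1) v = (A (init v), v last)`. [folklore] -/
@[simp] theorem liftCLM_apply (A : (Fin k → ℝ) →L[ℝ] (Fin k → ℝ)) (v : Fin (k + 1) → ℝ) :
    liftCLM A v = Fin.snoc (A (Fin.init v)) (v (Fin.last k)) := by
  ext i
  refine Fin.lastCases ?_ (fun j => ?_) i
  · simp [liftCLM]
  · simp [liftCLM]

/-- `init` of a standard basis vector `e_{castSucc j}` of `ℝᵏ⁺¹` is the basis vector `e_j` of `ℝᵏ`. [folklore] -/
theorem init_single_castSucc (j : Fin k) :
    Fin.init (Pi.single (Fin.castSucc j) (1 : ℝ) : Fin (k + 1) → ℝ) = Pi.single j 1 := by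
  ext i
  simp [Fin.init, Pi.single_apply, Fin.castSucc_inj]

/-- `init` of the last standard basis vector of `ℝᵏ⁺¹` vanishes. [folklore] -/
theorem init_single_last : Fin.init (Pi.single (Fin.last k) (1 : ℝ) : Fin (k + 1) → ℝ) = 0 := by
  ext i
  simp [Fin.init, (Fin.castSucc_lt_last i).ne]

/-- **`det (A ⊕ 1) = det A`** (Laplace expansion along the last row of the block matrix). [folklore] -/
theorem det_liftCLM (A : (Fin k → ℝ) →L[ℝ] (Fin k → ℝ)) : (liftCLM A).det = A.det := by
  change LinearMap.det (liftCLM A : (Fin (k + 1) → ℝ) →ₗ[ℝ] (Fin (k + 1) → ℝ)) =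
    LinearMap.det (A : (Fin k → ℝ) →ₗ[ℝ] (Fin k → ℝ))
  rw [← LinearMap.det_toMatrix', ← LinearMap.det_toMatrix', Matrix.det_succ_row _ (Fin.last k)]
  have hrow : ∀ j, LinearMap.toMatrix' (liftCLM A : (Fin (k + 1) → ℝ) →ₗ[ℝ] (Fin (k + 1) → ℝ)) (Fin.last k) j =
      if Fin.last k = j then 1 else 0 := by
    intro j
    rw [LinearMap.toMatrix'_apply, ContinuousLinearMap.coe_coe, liftCLM_apply, Fin.snoc_last, Pi.single_apply]
  have hsub : (LinearMap.toMatrix' (liftCLM A : (Fin (k + 1) → ℝ) →ₗ[ℝ] (Fin (k + 1) → ℝ))).submatrix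
      Fin.castSucc Fin.castSucc = LinearMap.toMatrix' (A : (Fin k → ℝ) →ₗ[ℝ] (Fin k → ℝ)) := by
    ext i j
    simp only [Matrix.submatrix_apply, LinearMap.toMatrix'_apply, ContinuousLinearMap.coe_coe, liftCLM_apply,
      Fin.snoc_castSucc, init_single_castSucc]
  rw [Finset.sum_eq_single (Fin.last k)]
  · rw [hrow, if_pos rfl, mul_one, Fin.succAbove_last, hsub]
    have h2 : ((Fin.last k : ℕ) + (Fin.last k : ℕ)) = 2 * k := by simp [two_mul]
    rw [h2, pow_mul]
    simp
  · intro j _ hj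
    rw [hrow, if_neg fun h => hj h.symm]
    simp
  · intro h
    exact absurd (Finset.mem_univ _) h

/-- The lift of a semialgebraic map is semialgebraic on the slab (coordinatewise: the `Φ`-coordinates through
`isSemialgebraicMapOn_iff_forall_holds` and `comp_init`, the last coordinate a polynomial). [folklore] -/
theorem isSemialgebraicMapOn_liftMap (r : IntegralRep k) {Φ : (Fin k → ℝ) → (Fin k → ℝ)}
    (hΦ : IsSemialgebraicMapOn ℚ r.domain Φ) : IsSemialgebraicMapOn ℚ (r.slabDomain 0) (liftMap Φ) := by
  refine IsSemialgebraicMapOn.of_forall (r.isSemialgebraic_slabDomain 0) fun i => ?_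
  refine Fin.lastCases ?_ (fun j => ?_) i
  · exact (isSemialgebraicFunOn_aeval (r.isSemialgebraic_slabDomain 0) (X (Fin.last k))).congr
      fun z _ => by simp [liftMap]
  · have hj : IsSemialgebraicFunOn ℚ r.domain (fun x => Φ x j) :=
      (isSemialgebraicMapOn_iff_forall_holds r.isSemialgebraic_domain).mp hΦ j
    exact (hj.comp_init.mono (fun z hz => hz.1) (r.isSemialgebraic_slabDomain 0)).congr
      fun z _ => by simp [liftMap]

/-- The lift is differentiable within the slab, with derivative `Φ' ⊕ 1`. [folklore] -/
theorem hasFDerivWithinAt_liftMap (r : IntegralRep k) {Φ : (Fin k → ℝ) → (Fin k → ℝ)}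
    {Φ' : (Fin k → ℝ) → (Fin k → ℝ) →L[ℝ] (Fin k → ℝ)} (hΦ' : ∀ x ∈ r.domain, HasFDerivWithinAt Φ (Φ' x) r.domain x)
    {z : Fin (k + 1) → ℝ} (hz : z ∈ r.slabDomain 0) :
    HasFDerivWithinAt (liftMap Φ) (liftCLM (Φ' (Fin.init z))) (r.slabDomain 0) z := by
  have hS : MapsTo Fin.init (r.slabDomain 0) r.domain := fun w hw => hw.1
  rw [hasFDerivWithinAt_pi']
  intro i
  refine Fin.lastCases ?_ (fun j => ?_) i
  · have e1 : (fun x => liftMap Φ x (Fin.last k)) = fun x => x (Fin.last k) := funext fun x => by simp [liftMap]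
    have e2 : (ContinuousLinearMap.proj (Fin.last k)).comp (liftCLM (Φ' (Fin.init z))) =
        ContinuousLinearMap.proj (R := ℝ) (φ := fun _ : Fin (k + 1) => ℝ) (Fin.last k) := by
      ext v
      simp
    rw [e1, e2]
    exact (ContinuousLinearMap.proj (R := ℝ) (φ := fun _ : Fin (k + 1) => ℝ) (Fin.last k)).hasFDerivWithinAt
  · have e1 : (fun x => liftMap Φ x (Fin.castSucc j)) = (fun v => v j) ∘ (Φ ∘ Fin.init) :=
      funext fun x => by simp [liftMap]
    have e2 : (ContinuousLinearMap.proj (Fin.castSucc j)).comp (liftCLM (Φ' (Fin.init z))) =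
        (ContinuousLinearMap.proj j).comp ((Φ' (Fin.init z)).comp (initL k)) := by
      ext v
      simp
    rw [e1, e2]
    have hinit : HasFDerivWithinAt Fin.init (initL k) (r.slabDomain 0) z := by
      have h := (initL k).hasFDerivWithinAt (s := r.slabDomain 0) (x := z)
      have hcoe : ((initL k : (Fin (k + 1) → ℝ) →L[ℝ] (Fin k → ℝ)) : (Fin (k + 1) → ℝ) → (Fin k → ℝ)) = Fin.init :=
        funext initL_apply
      rwa [hcoe] at h
    have hcomp : HasFDerivWithinAt (Φ ∘ Fin.init) ((Φ' (Fin.init z)).comp (initL k)) (r.slabDomain 0) z :=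
      (hΦ' (Fin.init z) (hS hz)).comp z hinit hS
    exact (ContinuousLinearMap.proj j).hasFDerivAt.comp_hasFDerivWithinAt z hcomp

/-- `init (Ψ z) = Φ (init z)` and `(Ψ z) last = z last`. [folklore] -/
theorem init_liftMap (Φ : (Fin k → ℝ) → (Fin k → ℝ)) (z : Fin (k + 1) → ℝ) :
    Fin.init (liftMap Φ z) = Φ (Fin.init z) ∧ liftMap Φ z (Fin.last k) = z (Fin.last k) := by
  simp [liftMap]

/-! ### The three moves, one dimension up -/

/-- **Rule (2) lifts**: if `[r] − [r']` is a change-of-variables instance along `Φ`, then `[r.slab 0] − [r'.slab 0]` is one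
along the lift `Ψ (x, t) = (Φ x, t)`. [Kontsevich–Zagier 2001, §1.2, rule (2)] [folklore] -/
theorem of_slab_sub_of_slab_mem_changeOfVariablesRel {c : FormalRep} (hc : c ∈ changeOfVariablesRel) :
    ∃ (k : ℕ) (r r' : IntegralRep k), c = of r - of r' ∧ of (r.slab 0) - of (r'.slab 0) ∈ changeOfVariablesRel := by
  obtain ⟨k, r, r', Φ, Φ', hΦ, hΦ', hinj, hdom, hf, rfl⟩ := hc
  refine ⟨k, r, r', rfl, k + 1, r.slab 0, r'.slab 0, liftMap Φ, fun z => liftCLM (Φ' (Fin.init z)),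
    isSemialgebraicMapOn_liftMap r hΦ, fun z hz => hasFDerivWithinAt_liftMap r hΦ' hz, ?_, ?_, ?_, rfl⟩
  · -- injective on the slab
    intro z hz w hw h
    have h1 : Φ (Fin.init z) = Φ (Fin.init w) := by
      rw [← (init_liftMap Φ z).1, ← (init_liftMap Φ w).1, h]
    have h2 : z (Fin.last k) = w (Fin.last k) := by
      rw [← (init_liftMap Φ z).2, ← (init_liftMap Φ w).2, h]
    have h3 : Fin.init z = Fin.init w := hinj hz.1 hw.1 h1
    rw [← Fin.snoc_init_self z, ← Fin.snoc_init_self w, h3, h2]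
  · -- the image of the slab over `σ` is the slab over `Φ '' σ`
    ext w
    simp only [IntegralRep.domain_slab, IntegralRep.slabDomain, mem_setOf_eq, mem_image, Nat.cast_zero, zero_add]
    constructor
    · rintro ⟨hw, h0, h1⟩
      rw [hdom] at hw
      obtain ⟨x, hx, hxw⟩ := hw
      refine ⟨Fin.snoc x (w (Fin.last k)), ⟨by simpa using hx, by simpa using h0, by simpa using h1⟩, ?_⟩
      simp only [liftMap, Fin.init_snoc, Fin.snoc_last, hxw, Fin.snoc_init_self]
    · rintro ⟨z, ⟨hz, h0, h1⟩, rfl⟩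
      refine ⟨?_, ?_, ?_⟩
      · rw [(init_liftMap Φ z).1, hdom]
        exact mem_image_of_mem Φ hz
      · rw [(init_liftMap Φ z).2]; exact h0
      · rw [(init_liftMap Φ z).2]; exact h1
  · -- the integrand transforms with the same Jacobian
    intro z hz
    simp only [IntegralRep.integrand_slab, det_liftCLM, (init_liftMap Φ z).1]
    exact hf (Fin.init z) hz.1

/-- **Rule (1a) lifts**: domain additivity of `σ = σ₁ ∪ σ₂` (null overlap) gives domain additivity of the slabs
`σ × [0,1] = σ₁ × [0,1] ∪ σ₂ × [0,1]` (the cylinder over the null overlap is null). [Kontsevich–Zagier 2001, §1.2, rule (1)]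
[folklore] -/
theorem of_slab_mem_domainAddRel {c : FormalRep} (hc : c ∈ domainAddRel) :
    ∃ (k : ℕ) (r r₁ r₂ : IntegralRep k), c = of r - of r₁ - of r₂ ∧
      of (r.slab 0) - of (r₁.slab 0) - of (r₂.slab 0) ∈ domainAddRel := by
  obtain ⟨k, r, r₁, r₂, hdom, hnull, h₁, h₂, rfl⟩ := hc
  refine ⟨k, r, r₁, r₂, rfl, k + 1, r.slab 0, r₁.slab 0, r₂.slab 0, ?_, ?_, ?_, ?_, rfl⟩
  · ext z
    simp only [IntegralRep.domain_slab, IntegralRep.slabDomain, hdom, mem_setOf_eq, mem_union]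
    tauto
  · refine measure_mono_null (fun z hz => ?_) (volume_setOf_init_mem_eq_zero hnull)
    exact ⟨hz.1.1, hz.2.1⟩
  · intro z hz
    simp only [IntegralRep.integrand_slab]
    exact h₁ hz.1
  · intro z hz
    simp only [IntegralRep.integrand_slab]
    exact h₂ hz.1

/-- **Rule (1b) lifts**: integrand additivity `f = f₁ + f₂` on `σ` gives integrand additivity on the slab.
[Kontsevich–Zagier 2001, §1.2, rule (1)] [folklore] -/
theorem of_slab_mem_integrandAddRel {c : FormalRep} (hc : c ∈ integrandAddRel) :
    ∃ (k : ℕ) (r r₁ r₂ : IntegralRep k), c = of r - of r₁ - of r₂ ∧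
      of (r.slab 0) - of (r₁.slab 0) - of (r₂.slab 0) ∈ integrandAddRel := by
  obtain ⟨k, r, r₁, r₂, h₁, h₂, hadd, rfl⟩ := hc
  refine ⟨k, r, r₁, r₂, rfl, k + 1, r.slab 0, r₁.slab 0, r₂.slab 0, ?_, ?_, ?_, rfl⟩
  · ext z
    simp only [IntegralRep.domain_slab, IntegralRep.slabDomain, h₁, mem_setOf_eq]
  · ext z
    simp only [IntegralRep.domain_slab, IntegralRep.slabDomain, h₂, mem_setOf_eq]
  · intro z hz
    simp only [IntegralRep.integrand_slab, Pi.add_apply]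
    exact hadd hz.1

/-- **Padding is functorial on rules 1a/1b/2**: the slab endomorphism `[s] ↦ [s.slab 0]` of `FormalRep` maps every
rule-1a/1b/2 instance into KZ₁₂ = closure (1a ∪ 1b ∪ 2) — verbatim the hypothesis `hC` of the telescope
(`Cruxes/SameDimRules12/Telescope.lean`). [Kontsevich–Zagier 2001, §1.2, rules (1), (2)] [folklore] -/
theorem slabFunctorial : ∀ c ∈ domainAddRel ∪ integrandAddRel ∪ changeOfVariablesRel,
    FreeAbelianGroup.map (fun p : (Σ n, IntegralRep n) => (⟨p.1 + 1, p.2.slab 0⟩ : Σ n, IntegralRep n)) c ∈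
      AddSubgroup.closure (domainAddRel ∪ integrandAddRel ∪ changeOfVariablesRel) := by
  have hof : ∀ {n : ℕ} (s : IntegralRep n),
      FreeAbelianGroup.map (fun p : (Σ n, IntegralRep n) => (⟨p.1 + 1, p.2.slab 0⟩ : Σ n, IntegralRep n)) (of s) =
        of (s.slab 0) := fun s => FreeAbelianGroup.map_of_apply _
  rintro c ((hc | hc) | hc)
  · obtain ⟨k, r, r₁, r₂, rfl, h⟩ := of_slab_mem_domainAddRel hc
    rw [map_sub, map_sub, hof, hof, hof]
    exact AddSubgroup.subset_closure (Or.inl (Or.inl h))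
  · obtain ⟨k, r, r₁, r₂, rfl, h⟩ := of_slab_mem_integrandAddRel hc
    rw [map_sub, map_sub, hof, hof, hof]
    exact AddSubgroup.subset_closure (Or.inl (Or.inr h))
  · obtain ⟨k, r, r', rfl, h⟩ := of_slab_sub_of_slab_mem_changeOfVariablesRel hc
    rw [map_sub, hof, hof]
    exact AddSubgroup.subset_closure (Or.inr h)

end Summit.KontsevichZagierPeriods.LevelPairing
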